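import Mathlib
import HarnessLib
import Literature.Computability.AlgebraicComplexity.MonotoneStructure
import Summits.ValiantsHypothesis.ValiantsHypothesis.Theorems.MonotoneRestorationMonotoneRestorationQPChooseLeCard

/-!
# ValiantsHypothesis / MonotoneRestoration — `MonotoneRestorationQP`, line `Sketch`, helpers for stub H2

Support file for crux item `stmt-ValiantsHypothesis-15886`
(`Summit.ValiantsHypothesis.ValiantsHypothesis.Theses.MonotoneRestoration.MonotoneRestorationQP`),
line `Sketch`: generic "row shadow" lemmas used by the stub `stub_gammaDroppingGate` (file
`MonotoneRestorationMonotoneRestorationQPGammaDroppingGate.lean`); the filling lemma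
`gammaDrop_compl_subset_shadow` is the registered sub-goal this file discharges.

For a monomial `m` in doubly indexed variables `x_{ij}` write `rows m` for the support of its row
degrees (`rowDegrees m`, `MonotoneStructure.lean`) and, for a polynomial `p`, `shadow p` for the
union of the rows of its monomials — always spelled out as
`p.support.biUnion fun m => (rowDegrees m).support`. This file proves:

* rows are additive (`gammaDrop_rows_add`), and inside a row-multilinear polynomial the rows of
  two factors of a monomial are disjoint (`gammaDrop_rows_disjoint`);
* the shadow of a (finite) product lies in the union of the shadows of the factors
  (`gammaDrop_shadow_mul_subset`, `gammaDrop_shadow_prod_subset`);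
* renaming along the diagonal `(i, j) ↦ (ρ i, ρ j)` maps the shadow by `ρ`
  (`gammaDrop_shadow_rename_diag`, via `gamma_rowDegrees_mapDomain` of the G6 file
  `MonotoneRestorationMonotoneRestorationQPChooseLeCard.lean`), so a fixed polynomial has a
  `ρ`-stable shadow (`gammaDrop_shadow_stable`); as even permutations fixing `X` pointwise are
  transitive on `[n] ∖ X` when `|X| + 3 ≤ n` (`gamma_exists_threeCycle`, same file), a polynomial
  fixed by all of them whose shadow meets `[n] ∖ X` has all of `[n] ∖ X` in its shadow
  (`gammaDrop_compl_subset_shadow`);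
* homogeneity bookkeeping: degrees of monomials of homogeneous polynomials, and homogeneity of
  a polynomial whose monomials shift into a homogeneous one (`gammaDrop_isHomogeneous_of_extend`).
-/

-- `Summit.ValiantsHypothesis.ValiantsHypothesis.…` is the tree's mandated single-conjunct layout
-- (Sub = Summit), so the duplicated namespace component is intended.
set_option linter.dupNamespace false

noncomputable section

namespace Summit.ValiantsHypothesis.ValiantsHypothesis.Theorems

open Literature.Computability.AlgebraicComplexity MvPolynomial
open scoped Pointwise

/-! ### Rows and shadows of monomials and polynomials -/

section Shadows

variable {ι : Type*} {κ : Type*}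

/-- The rows of a product of monomials are the rows of the factors. [folklore] -/
theorem gammaDrop_rows_add [DecidableEq ι] (m m' : ι × κ →₀ ℕ) :
    (rowDegrees (m + m')).support = (rowDegrees m).support ∪ (rowDegrees m').support := by
  ext i
  simp only [rowDegrees_add, Finsupp.mem_support_iff, Finsupp.add_apply, Finset.mem_union]
  omega

/-- Row-multilinearity separates rows: if `m + m' + μ` is a monomial of a polynomial all of whose
monomials use every row at most once, the rows of `m` and of `m'` are disjoint. [folklore] -/
theorem gammaDrop_rows_disjoint {R : Type*} [CommSemiring R] {f : MvPolynomial (ι × κ) R}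
    (hrow : ∀ m ∈ f.support, ∀ i, rowDegrees m i ≤ 1) {m m' μ : ι × κ →₀ ℕ}
    (h : m + m' + μ ∈ f.support) :
    Disjoint (rowDegrees m).support (rowDegrees m').support := by
  rw [Finset.disjoint_left]
  intro i hi hi'
  rw [Finsupp.mem_support_iff] at hi hi'
  have := hrow _ h i
  simp only [rowDegrees_add, Finsupp.add_apply] at this
  omega

/-- The shadow of a product lies in the union of the shadows of the factors. [folklore] -/
theorem gammaDrop_shadow_mul_subset [DecidableEq ι] [DecidableEq κ] {R : Type*} [CommSemiring R]
    (p q : MvPolynomial (ι × κ) R) :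
    ((p * q).support.biUnion fun m => (rowDegrees m).support) ⊆
      (p.support.biUnion fun m => (rowDegrees m).support) ∪
        (q.support.biUnion fun m => (rowDegrees m).support) := by
  intro i hi
  obtain ⟨m, hm, him⟩ := Finset.mem_biUnion.1 hi
  obtain ⟨a, ha, b, hb, rfl⟩ := Finset.mem_add.1 (support_mul p q hm)
  rw [gammaDrop_rows_add, Finset.mem_union] at him
  rcases him with h | h
  · exact Finset.mem_union_left _ (Finset.mem_biUnion.2 ⟨a, ha, h⟩)
  · exact Finset.mem_union_right _ (Finset.mem_biUnion.2 ⟨b, hb, h⟩)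

/-- The shadow of a finite product lies in any set containing the shadows of the factors.
[folklore] -/
theorem gammaDrop_shadow_prod_subset [DecidableEq ι] [DecidableEq κ] {R : Type*} [CommSemiring R]
    {α : Type*} (s : Finset α) (g : α → MvPolynomial (ι × κ) R) (S : Finset ι)
    (h : ∀ x ∈ s, ((g x).support.biUnion fun m => (rowDegrees m).support) ⊆ S) :
    ((∏ x ∈ s, g x).support.biUnion fun m => (rowDegrees m).support) ⊆ S := by
  refine Finset.prod_induction g
    (fun u => (u.support.biUnion fun m => (rowDegrees m).support) ⊆ S) ?_ ?_ h
  · intro a b ha hb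
    exact (gammaDrop_shadow_mul_subset a b).trans (Finset.union_subset ha hb)
  · intro i hi
    obtain ⟨m, hm, him⟩ := Finset.mem_biUnion.1 hi
    have hm' : m ∈ (monomial (0 : ι × κ →₀ ℕ) (1 : R)).support := by
      rwa [← C_apply, C_1]
    have h0 : m = 0 := Finset.mem_singleton.1 (support_monomial_subset hm')
    rw [h0, rowDegrees_zero] at him
    simp at him

/-- Renaming along the diagonal map of `ρ` maps the shadow by `ρ`. [folklore] -/
theorem gammaDrop_shadow_rename_diag {n : ℕ} {R : Type*} [CommSemiring R] (ρ : Equiv.Perm (Fin n))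
    (p : MvPolynomial (Fin n × Fin n) R) :
    ((rename (fun x : Fin n × Fin n => (ρ x.1, ρ x.2)) p).support.biUnion
        fun m => (rowDegrees m).support) =
      (p.support.biUnion fun m => (rowDegrees m).support).image ρ := by
  rw [support_rename_of_injective (gamma_diag_injective ρ), Finset.image_biUnion,
    Finset.biUnion_image]
  refine Finset.biUnion_congr rfl fun m _ => ?_
  rw [gamma_rowDegrees_mapDomain, Finsupp.mapDomain_support_of_injective ρ.injective]

/-- A polynomial fixed by the diagonal renaming along `ρ` has a `ρ`-stable shadow. [folklore] -/
theorem gammaDrop_shadow_stable {n : ℕ} {R : Type*} [CommSemiring R] (ρ : Equiv.Perm (Fin n))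
    (p : MvPolynomial (Fin n × Fin n) R)
    (h : rename (fun x : Fin n × Fin n => (ρ x.1, ρ x.2)) p = p) {i : Fin n}
    (hi : i ∈ (p.support.biUnion fun m => (rowDegrees m).support)) :
    ρ i ∈ (p.support.biUnion fun m => (rowDegrees m).support) := by
  have key := gammaDrop_shadow_rename_diag ρ p
  rw [h] at key
  rw [key]
  exact Finset.mem_image_of_mem ρ hi

/-- **Filling (registered sub-goal of stub H2).** A polynomial over `ℝ≥0` in the matrix variables
fixed by all even permutations fixing `X` pointwise (acting diagonally, `|X| + 3 ≤ n`) whose shadow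
meets `[n] ∖ X` has all of `[n] ∖ X` in its shadow: move the touched row by an even permutation
fixing `X` (`gamma_exists_threeCycle`) and use the stability of the shadow. [new] -/
theorem gammaDrop_compl_subset_shadow {n : ℕ} (X : Finset (Fin n)) (hX : X.card + 3 ≤ n)
    (p : MvPolynomial (Fin n × Fin n) NNReal)
    (hinv : ∀ ρ : Equiv.Perm (Fin n), (∀ x ∈ X, ρ x = x) → Equiv.Perm.sign ρ = 1 →
      MvPolynomial.rename (fun x : Fin n × Fin n => (ρ x.1, ρ x.2)) p = p)
    {i₀ : Fin n} (hi₀X : i₀ ∉ X) (hi₀ : i₀ ∈ (p.support.biUnion fun m => (rowDegrees m).support))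
    {i : Fin n} (hiX : i ∉ X) :
    i ∈ (p.support.biUnion fun m => (rowDegrees m).support) := by
  obtain ⟨ρ, hρX, hρs, hρi⟩ := gamma_exists_threeCycle hX hi₀X hiX
  rw [← hρi]
  exact gammaDrop_shadow_stable ρ p (hinv ρ hρX hρs) hi₀

end Shadows

/-! ### Homogeneity bookkeeping -/

/-- The monomials of a homogeneous polynomial have the degree of homogeneity. [folklore] -/
theorem gammaDrop_degree_eq_of_mem_support {σ R : Type*} [CommSemiring R] {φ : MvPolynomial σ R}
    {e : ℕ} (hφ : φ.IsHomogeneous e) {m : σ →₀ ℕ} (hm : m ∈ φ.support) : m.degree = e := by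
  rw [Finsupp.degree_apply]
  exact (hφ.degree_eq_sum_deg_support hm).symm

/-- A polynomial all of whose monomials have degree `e` is homogeneous of degree `e`. [folklore] -/
theorem gammaDrop_isHomogeneous_of_degree {σ R : Type*} [CommSemiring R] {φ : MvPolynomial σ R}
    {e : ℕ} (h : ∀ m ∈ φ.support, m.degree = e) : φ.IsHomogeneous e := by
  intro m hm
  have key := h m (mem_support_iff.2 hm)
  rw [Finsupp.degree_eq_weight_one] at key
  exact key

/-- A polynomial whose monomials, shifted by one common monomial, become monomials of a
homogeneous polynomial is homogeneous (of its total degree). [folklore] -/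
theorem gammaDrop_isHomogeneous_of_extend {σ R : Type*} [CommSemiring R] {f p : MvPolynomial σ R}
    {d : ℕ} (hf : f.IsHomogeneous d) {μ : σ →₀ ℕ} (h : ∀ m ∈ p.support, m + μ ∈ f.support) :
    p.IsHomogeneous p.totalDegree := by
  by_cases hp : p = 0
  · rw [hp]
    exact isHomogeneous_zero _ _ _
  have hhom : p.IsHomogeneous (d - μ.degree) := by
    apply gammaDrop_isHomogeneous_of_degree
    intro m hm
    have key := gammaDrop_degree_eq_of_mem_support hf (h m hm)
    rw [map_add] at key
    omega
  rwa [hhom.totalDegree hp]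

end Summit.ValiantsHypothesis.ValiantsHypothesis.Theorems

end
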